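import Mathlib
import Literature.Geometry.Lorentzian.FinalState
import Literature.Geometry.Lorentzian.CauchyDevelopment
import Literature.Geometry.Lorentzian.KerrConvergence
import Literature.Geometry.Lorentzian.KerrSchild
import Literature.Uncategorized.HonestCore
import Literature.Uncategorized.LateEscape
import HarnessLib

/-!
# SubwallClosureOfNoEscape

Topic `Literature/Uncategorized`. Named literature fact(s) relocated by the gate from `Summits/FinalStateConjecture/FinalStateConjecture/Theorems/StarvedNecksNeckGapDecayStubSubwallClosureOfNoEscape.lean`
(accept-time relocation of `[cite]`d propositions written inline in a Summits proposal; human ruling 2026-08-15).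

* `Literature.Uncategorized.SubwallClosureOfNoEscape`
-/

namespace Literature.Uncategorized

open scoped Manifold ContDiff Topology ENNReal
open Filter Set MeasureTheory Topology Literature.Geometry.Lorentzian Literature.Uncategorized

/-- **S4a — sub-wall closedness from no late escape**: in any vacuum Cauchy development, for a `C⁴` decomposition
`d` of `O` with `HonestCore(d, R₀)`, a hole `i`, `R₀ ≤ R₁`, `τ₀ ≤ τ₁`, a continuous wall `W`, and a chart `Ψg`
with G1 (on the late tube `{τ₁ < t, r < W(x⁰)+1}`) and G2 (`= Ψᵢ` inside `R₁+1`): from any `τ₂ ≥ τ₁` without a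
late escaping sequence, the sub-wall late tube portions `Ψg{τ' ≤ t, r ≤ ϱ(t)}` (`τ' > τ₂`, `ϱ` continuous) are
relatively closed in `O` (G5 from `τ₂`).  Inside `R₁+1` this is `Hc`(3) for the input chart with profile
`min(ϱ, R₁+1)`; outside, bounded chart times give a compact coordinate set inside the tube. [folklore] -/
def SubwallClosureOfNoEscape : Prop :=
  ∀ (X : Type) [TopologicalSpace X] [ChartedSpace E3 X] [IsManifold (𝓡 3) ∞ X] [ConnectedSpace X]
    (D : InitialDataSet (𝓡 3) X) (𝒟 : VacuumCauchyDevelopment D)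
    (O : Set 𝒟.carrier) (d : FinalStateDecomposition 𝒟.toSpacetime O 4) (R₀ : ℝ),
    HonestCore 𝒟.toSpacetime O 4 d R₀ →
    ∀ (i : Fin d.N) (R₁ τ₁ : ℝ) (W : ℝ → ℝ) (Ψg : (d.background i).domain → 𝒟.carrier),
      let B := d.background i; let t := B.time; let r := B.radius;
      R₀ ≤ R₁ → d.τ₀ ≤ τ₁ → Continuous W →
      (let U : Set B.domain := {x | τ₁ < t x.1 ∧ r x.1 < W (x.1 0) + 1};
        ContMDiffOn 𝓘(ℝ, E4) (𝓡 4) ∞ Ψg U ∧ Topology.IsOpenEmbedding (U.restrict Ψg) ∧ Ψg '' U ⊆ d.charted) →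
      (∀ x : B.domain, r x.1 ≤ R₁ + 1 → Ψg x = d.chart i x) →
      ∀ τ₂ : ℝ, τ₁ ≤ τ₂ → ¬ LateEscape 𝒟.toSpacetime O B Ψg R₁ τ₂ W →
        ∀ (τ' : ℝ) (ϱ : ℝ → ℝ), Continuous ϱ → τ₂ < τ' →
          (∀ x : B.domain, τ' ≤ t x.1 → r x.1 ≤ ϱ (t x.1) → r x.1 ≤ W (x.1 0)) →
          closure (Ψg '' {x | τ' ≤ t x.1 ∧ r x.1 ≤ ϱ (t x.1)}) ∩ O ⊆ Ψg '' {x | τ' ≤ t x.1 ∧ r x.1 ≤ ϱ (t x.1)}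

/-! ## Elementary helpers -/

end Literature.Uncategorized
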